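import Summits.ValiantsHypothesis.ValiantsHypothesis.Theorems.SymPencilPerFourInnerRankRows

/-!
# Route `SymPencil` — transport of `per [𝟙; a; b; c]` and of linear maps along a coordinate
# permutation (tool file, `--supports` stmt-ValiantsHypothesis-5674; nothing here bears on `VP ≠ VNP`)

For `σ ∈ S₄` acting on `K⁴` by `P_σ v = v ∘ σ` (`LinearMap.funLeft`): `per [𝟙; a∘σ; b∘σ; c∘σ] =
per [𝟙; a; b; c]` (`per_comp_perm`, a column permutation), and for a linear map `A` of `K⁴` the
conjugate `P_σ A P_σ⁻¹` (`conj_apply`) inherits self-adjointness for the forms `per [𝟙; ·; ·; c]`,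
`c ∈ ker (μ ∘ P_σ⁻¹)` (`selfAdjoint_conj`) and square-zero (`sq_conj`); `(μ ∘ P_σ⁻¹)(e_p) = μ(e_{σ p})`
(`conj_single`), `e_i ∘ σ = e_{σ⁻¹ i}` (`single_comp_perm`).  Used to normalise indices in the
rank-one lemma of the pencil core (`SymPencilPerFourHyperplanePencilRankOneB`).  Elementary. [folklore]
-/

-- single-conjunct layout: Sub = Summit, duplicated namespace component intended
set_option linter.dupNamespace false

namespace Summit.ValiantsHypothesis.ValiantsHypothesis.Theorems.SymPencilPerFourHyperplanePencilPerm

open Matrix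

variable {K : Type*} [Field K]

/-! ### Transport along a coordinate permutation -/

/-- `per [𝟙; a ∘ σ; b ∘ σ; c ∘ σ] = per [𝟙; a; b; c]`. [folklore] -/
theorem per_comp_perm (σ : Equiv.Perm (Fin 4)) (a b c : Fin 4 → K) :
    (Matrix.of ![(fun _ => (1 : K)), a ∘ σ, b ∘ σ, c ∘ σ]).permanent =
      (Matrix.of ![(fun _ => (1 : K)), a, b, c]).permanent := by
  have h : Matrix.of ![(fun _ => (1 : K)), a ∘ σ, b ∘ σ, c ∘ σ] =
      (Matrix.of ![(fun _ => (1 : K)), a, b, c]).submatrix id σ := by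
    ext i j; fin_cases i <;> rfl
  rw [h, Matrix.permanent_permute_rows]

/-- `LinearMap.funLeft` is composition. [folklore] -/
theorem funLeft_eq_comp (σ : Equiv.Perm (Fin 4)) (v : Fin 4 → K) :
    LinearMap.funLeft K K σ v = v ∘ σ := rfl

omit [Field K] in
/-- `(v ∘ σ⁻¹) ∘ σ = v`. [folklore] -/
theorem comp_symm_comp (σ : Equiv.Perm (Fin 4)) (v : Fin 4 → K) : (v ∘ σ.symm) ∘ σ = v := by
  funext p; simp

omit [Field K] in
/-- `(v ∘ σ) ∘ σ⁻¹ = v`. [folklore] -/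
theorem comp_comp_symm (σ : Equiv.Perm (Fin 4)) (v : Fin 4 → K) : (v ∘ σ) ∘ σ.symm = v := by
  funext p; simp

/-- `e_i ∘ σ = e_{σ⁻¹ i}`. [folklore] -/
theorem single_comp_perm (σ : Equiv.Perm (Fin 4)) (i : Fin 4) :
    (Pi.single i (1 : K) : Fin 4 → K) ∘ σ = Pi.single (σ.symm i) 1 := by
  funext p
  simp only [Function.comp_apply, Pi.single_apply, Equiv.apply_eq_iff_eq_symm_apply]

/-- The conjugate `a ↦ (A (a ∘ σ⁻¹)) ∘ σ`, evaluated. [folklore] -/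
theorem conj_apply (σ : Equiv.Perm (Fin 4)) (A : (Fin 4 → K) →ₗ[K] (Fin 4 → K)) (a : Fin 4 → K) :
    (LinearMap.funLeft K K σ ∘ₗ A ∘ₗ LinearMap.funLeft K K σ.symm) a = (A (a ∘ σ.symm)) ∘ σ := rfl

/-- Self-adjointness transports to the conjugate (with `μ ↦ μ ∘ P_σ⁻¹`). [folklore] -/
theorem selfAdjoint_conj (σ : Equiv.Perm (Fin 4)) (μ : (Fin 4 → K) →ₗ[K] K)
    (A : (Fin 4 → K) →ₗ[K] (Fin 4 → K))
    (hsa : ∀ a b c : Fin 4 → K, μ c = 0 →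
      (Matrix.of ![(fun _ => (1 : K)), A a, b, c]).permanent =
        (Matrix.of ![(fun _ => (1 : K)), a, A b, c]).permanent)
    (a b c : Fin 4 → K) (hc : (μ ∘ₗ LinearMap.funLeft K K σ.symm) c = 0) :
    (Matrix.of ![(fun _ => (1 : K)),
        (LinearMap.funLeft K K σ ∘ₗ A ∘ₗ LinearMap.funLeft K K σ.symm) a, b, c]).permanent =
      (Matrix.of ![(fun _ => (1 : K)), a,
        (LinearMap.funLeft K K σ ∘ₗ A ∘ₗ LinearMap.funLeft K K σ.symm) b, c]).permanent := by
  rw [conj_apply, conj_apply]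
  have h := hsa (a ∘ σ.symm) (b ∘ σ.symm) (c ∘ σ.symm) hc
  rw [← per_comp_perm σ, ← per_comp_perm σ (a ∘ σ.symm), comp_symm_comp, comp_symm_comp,
    comp_symm_comp] at h
  exact h

/-- Square-zero transports to the conjugate. [folklore] -/
theorem sq_conj (σ : Equiv.Perm (Fin 4)) (A : (Fin 4 → K) →ₗ[K] (Fin 4 → K))
    (hsq : ∀ a, A (A a) = 0) (a : Fin 4 → K) :
    (LinearMap.funLeft K K σ ∘ₗ A ∘ₗ LinearMap.funLeft K K σ.symm)
      ((LinearMap.funLeft K K σ ∘ₗ A ∘ₗ LinearMap.funLeft K K σ.symm) a) = 0 := by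
  rw [conj_apply, conj_apply, comp_comp_symm, hsq]; rfl

/-- `μ ∘ P_σ⁻¹` is non-zero if `μ` is. [folklore] -/
theorem ne_zero_conj (σ : Equiv.Perm (Fin 4)) (μ : (Fin 4 → K) →ₗ[K] K) (hμ : μ ≠ 0) :
    μ ∘ₗ LinearMap.funLeft K K σ.symm ≠ 0 := by
  intro h; apply hμ; apply LinearMap.ext; intro v
  have := LinearMap.congr_fun h (v ∘ σ)
  rw [LinearMap.comp_apply, funLeft_eq_comp, comp_comp_symm, LinearMap.zero_apply] at this
  rw [this, LinearMap.zero_apply]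

/-- `(μ ∘ P_σ⁻¹)(e_p) = μ(e_{σ p})`. [folklore] -/
theorem conj_single (σ : Equiv.Perm (Fin 4)) (μ : (Fin 4 → K) →ₗ[K] K) (p : Fin 4) :
    (μ ∘ₗ LinearMap.funLeft K K σ.symm) (Pi.single p 1) = μ (Pi.single (σ p) 1) := by
  rw [LinearMap.comp_apply, funLeft_eq_comp, single_comp_perm]; simp

end Summit.ValiantsHypothesis.ValiantsHypothesis.Theorems.SymPencilPerFourHyperplanePencilPerm
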